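import Literature.NumberTheory.Rogawski1990.AdelicStableClassSupportFiniteSemisimple
import Literature.NumberTheory.Rogawski1990.SingularSemisimpleElement
import Literature.NumberTheory.Rogawski1990.EndoscopicTorusPartnerRankTwo
import Literature.NumberTheory.Rogawski1990.StableClassRegular
import Literature.NumberTheory.Rogawski1990.StableClassHRegular
import Literature.NumberTheory.Rogawski1990.EndoscopicClassTransfer
import Literature.NumberTheory.QuadraticForms.LandherrHermitianMatricesDiagonalize
import Literature.LinearAlgebra.Matrix.JordanDecompositionUnique
import HarnessLib

/-!
# Every SINGULAR (non-regular) semisimple stable class of `U(H)(L⁺)` occurs in every inner form `U(H′)(L⁺)`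
(Rogawski (1990), §3.8 Prop. 3.8.1 p. 27 (singular semisimple `γ`: eigenvalues `{α, α, β}`), §14.1 p. 232 («`γ` occurs in `G′`»), §14.5 pp. 238–239
(the singular classes in the elliptic part of the trace formula of the anisotropic `G′`))

Topic `NumberTheory/Rogawski1990`; namespace `Literature.NumberTheory.Rogawski1990`.  THEOREMS ONLY (no definition, no instance, no notation, no
named fact, no `sorry`).  Cell `pub/hodgecm-mathlib` (D-0151), ENGINE T1, row O7 «SINGULAR semisimple stable classes» (F0P3a-p01 (g5) 09:48:55Z
placement (A1) under RULING #108 (4); consumer: the OCCURRENCE half of `LawT1bVanish` ∕ the SingularClassPackage of CENSUS-O7 v3 (A-p01 (g15))).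

THE MATHEMATICS.  Over a CM field `L` (conjugation `σ`), let `H, H′ ∈ M₃(L)` be non-degenerate hermitian.  A semisimple `γ ∈ U(H)(L⁺)` that is
NOT regular (inseparable characteristic polynomial) has characteristic polynomial `(X − a)²(X − b)` with `σ(a)a = σ(b)b = 1` (`a = b` iff `γ` is the
scalar `a·1`; the non-scalar case is ★ `exists_singular_frame_of_isSemisimpleElt`, Prop. 3.8.1).  Diagonalising `H′` over `L` (★ Landherr
`exists_congr_diagonal`: `ᵗ(σg) H′ g = diag(d)`), the matrix `g · diag(a, a, b) · g⁻¹` lies in `U(H′)(L⁺)` (★ `diagonal_mem_unitaryGroup_diagonal` +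
★ `unitaryGroupCongr`), is semisimple (★ `isSemisimple_of_eq_conj_diagonal`) and has the same characteristic polynomial; two semisimple elements of
`GL₃(L)` with the same characteristic polynomial are conjugate (★ `isConj_units_of_charpoly_eq_of_isSemisimple`, K6-γ), i.e. `γ′ ↔ γ`
(★ `Corresponds`).  Hence the stable class of `γ` OCCURS in `U(H′)` (★ `StableClass.OccursIn`) — no local–global principle, no anisotropy, no regularity.

* §1 `charpoly_eq_of_smul_one_mem` (a unitary scalar `ζ·1`: `σ(ζ)ζ = 1`), **`exists_charpoly_eq_of_isSemisimpleElt_of_not_isRegularElt`**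
  (`charpoly γ = (X − C a)^2 * (X − C b)`, `σ(a)a = σ(b)b = 1`).
* §2 **`exists_isSemisimpleElt_charpoly_eq_prod`** — for ANY non-degenerate hermitian `H′ ∈ M_n(L)` and unitary scalars `u i` there is a semisimple
  `γ′ ∈ U(H′)(L⁺)` with `charpoly γ′ = ∏ (X − C (u i))`.
* §3 **`StableClass.occursIn_of_isSemisimple_of_not_isRegular`** (HEAD): a semisimple non-regular stable class of `U(H)(L⁺)` occurs in `U(H′)(L⁺)`;
  element form `exists_corresponds_of_isSemisimpleElt_of_not_isRegularElt`.
* §4 endoscopic reading **`StableClassH.exists_transfersTo_of_not_isGRegular`**: a stable class of `H = U(J₂) × U(J₁)` whose image class in `U(J₃)`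
  (`endoForm J₂ J₁ = J₃`) is semisimple and NOT `G`-regular transfers (★ `StableClassH.TransfersTo`) to some stable class of every inner form `U(H′)`.
HC_CM is proved only modulo the printed citations until rung 0 closes; this file is count-neutral linear algebra over ★ currency.

## References
* [Rogawski1990] J. D. Rogawski, *Automorphic Representations of Unitary Groups in Three Variables*, Ann. of Math. Stud. 123 (1990), §3.8 Prop. 3.8.1
  p. 27; §14.1 p. 232; §14.5 pp. 238–239.
* [Landherr1936HermitianForms] W. Landherr, *Äquivalenz Hermitescher Formen über einem beliebigen algebraischen Zahlkörper*, Abh. Math. Sem. Hamburg 11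
  (1936) (diagonalisation of hermitian forms).
-/

set_option autoImplicit false

noncomputable section

open Polynomial NumberField
open scoped MatrixGroups Matrix

namespace Literature.NumberTheory.Rogawski1990

open Literature.AlgebraicGeometry.ShimuraVarieties (unitaryGroup mem_unitaryGroup_iff)
open Literature.NumberTheory.Automorphic (cmConjRingHom cmConjRingHom_apply unitaryGroupCongr formCongr)
open Literature.NumberTheory.QuadraticForms

variable {L : Type} [Field L] [NumberField L] [IsCMField L]

/-- The tree's two spellings of the conjugate transpose agree: `Landherr.conjTranspose L A = (A.map (cmConjRingHom L))ᵀ`. [folklore] -/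
private theorem landherr_conjTranspose_eq' {m n : Type} (A : Matrix m n L) :
    Landherr.conjTranspose L A = (A.map (cmConjRingHom L))ᵀ := rfl

/-! ## §1 The characteristic polynomial of a singular semisimple element of `U(H)(L⁺)` -/

section Charpoly

variable {H : Matrix (Fin 3) (Fin 3) L}

/-- **A unitary scalar**: if `ζ·1 ∈ U(H)(L⁺)` with `H` non-degenerate, then `σ(ζ)ζ = 1`. [cite: Rogawski1990, §3.8 p. 27] -/
theorem conj_mul_self_eq_one_of_smul_one_mem (hdet : H.det ≠ 0) {ζ : L} {γ : GL (Fin 3) L}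
    (hγ : γ ∈ unitaryGroup (cmConjRingHom L) H) (hζ : (γ : Matrix (Fin 3) (Fin 3) L) = ζ • (1 : Matrix (Fin 3) (Fin 3) L)) :
    cmConjRingHom L ζ * ζ = 1 := by
  have h := (mem_unitaryGroup_iff).mp hγ
  rw [hζ, Matrix.smul_one_eq_diagonal, Matrix.diagonal_map (map_zero _), Matrix.diagonal_transpose, ← Matrix.smul_one_eq_diagonal,
    ← Matrix.smul_one_eq_diagonal, Matrix.smul_mul, Matrix.one_mul, Matrix.mul_smul, Matrix.mul_one, smul_smul] at h
  -- `(σζ ζ) • H = H` with `H ≠ 0`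
  have hH0 : H ≠ 0 := fun h0 => hdet (by rw [h0, Matrix.det_zero])
  by_contra hne
  apply hH0
  have h3 : (cmConjRingHom L ζ * ζ - 1) • H = 0 := by rw [mul_comm, sub_smul, one_smul, h, sub_self]
  rcases smul_eq_zero.mp h3 with h4 | h4
  · exact absurd (sub_eq_zero.mp h4) hne
  · exact h4

/-- **The characteristic polynomial of a SINGULAR semisimple `γ ∈ U(H)(L⁺)`** (`H ∈ M₃(L)` non-degenerate hermitian): if `γ` is semisimple
(★ `IsSemisimpleElt`) and NOT regular (★ `IsRegularElt` fails: the characteristic polynomial is inseparable), then `charpoly γ = (X − a)²(X − b)`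
with `σ(a)a = σ(b)b = 1` — the scalar case `γ = a·1` (`b = a`) or the frame of ★ `exists_singular_frame_of_isSemisimpleElt` (`γP = P(a·1₂ ⊕ b·1₁)`).
[cite: Rogawski1990, §3.8 Prop. 3.8.1 p. 27] -/
theorem exists_charpoly_eq_of_isSemisimpleElt_of_not_isRegularElt (hH : (H.map (cmConjRingHom L))ᵀ = H) (hdet : H.det ≠ 0)
    (γ : unitaryGroup (cmConjRingHom L) H) (hss : IsSemisimpleElt (cmConjRingHom L) H γ) (hnreg : ¬ IsRegularElt (γ : GL (Fin 3) L)) :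
    ∃ a b : L, cmConjRingHom L a * a = 1 ∧ cmConjRingHom L b * b = 1 ∧
      ((γ : GL (Fin 3) L) : Matrix (Fin 3) (Fin 3) L).charpoly = (X - C a) ^ 2 * (X - C b) := by
  by_cases hsc : ∃ ζ : L, ((γ : GL (Fin 3) L) : Matrix (Fin 3) (Fin 3) L) = ζ • (1 : Matrix (Fin 3) (Fin 3) L)
  · -- scalar: `charpoly = (X − ζ)³`
    obtain ⟨ζ, hζ⟩ := hsc
    have hu := conj_mul_self_eq_one_of_smul_one_mem hdet γ.2 hζ
    refine ⟨ζ, ζ, hu, hu, ?_⟩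
    rw [hζ, Matrix.smul_one_eq_diagonal, Matrix.charpoly_diagonal, Finset.prod_const, Finset.card_univ, Fintype.card_fin]
    ring
  · -- singular non-central: the frame `γ P = P (a·1₂ ⊕ᶠ b·1₁)`
    push Not at hsc
    have hσσ : ∀ r : L, cmConjRingHom L (cmConjRingHom L r) = r := fun r => IsCMField.complexConj_apply_apply L r
    obtain ⟨a, b, P, Ha, Hb, -, haa, hbb, -, hγP, -, -, -, -⟩ :=
      exists_singular_frame_of_isSemisimpleElt (cmConjRingHom L) hσσ H hH hdet γ hss hnreg hsc
    refine ⟨a, b, haa, hbb, ?_⟩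
    -- the block matrix is the diagonal matrix `diag(a, a, b)`
    have hD : Literature.NumberTheory.Automorphic.UnitaryGroup.finSum 2 1 (a • (1 : Matrix (Fin 2) (Fin 2) L))
        (b • (1 : Matrix (Fin 1) (Fin 1) L)) =
        Matrix.diagonal (Sum.elim (fun _ : Fin 2 => a) (fun _ : Fin 1 => b) ∘ finSumFinEquiv.symm) := by
      rw [Literature.NumberTheory.Automorphic.UnitaryGroup.finSum, Matrix.smul_one_eq_diagonal, Matrix.smul_one_eq_diagonal,
        Matrix.fromBlocks_diagonal, Matrix.reindex_apply, Matrix.submatrix_diagonal_equiv]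
    -- `γ = P D P⁻¹`
    have hconj : ((γ : GL (Fin 3) L) : Matrix (Fin 3) (Fin 3) L) =
        (P : Matrix (Fin 3) (Fin 3) L) * Matrix.diagonal (Sum.elim (fun _ : Fin 2 => a) (fun _ : Fin 1 => b) ∘ finSumFinEquiv.symm) *
          ((P⁻¹ : GL (Fin 3) L) : Matrix (Fin 3) (Fin 3) L) := by
      rw [← hD, ← hγP, Matrix.mul_assoc, ← Units.val_mul, mul_inv_cancel, Units.val_one, Matrix.mul_one]
    rw [hconj, Matrix.coe_units_inv, Matrix.charpoly_units_conj, Matrix.charpoly_diagonal]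
    -- `∏_{i : Fin 3} (X − C (d i)) = (X − C a)^2 (X − C b)` through `Fin 2 ⊕ Fin 1`
    rw [← finSumFinEquiv.prod_comp, Fintype.prod_sum_type]
    simp only [Function.comp_apply, Equiv.symm_apply_apply, Sum.elim_inl, Sum.elim_inr, Finset.prod_const, Finset.card_univ,
      Fintype.card_fin, pow_one]

end Charpoly

/-! ## §2 A semisimple element of `U(H′)(L⁺)` with prescribed unitary eigenvalues -/

section Construction

variable {n : Type} [Fintype n] [DecidableEq n]

/-- **Prescribed unitary eigenvalues are realised in every `U(H′)(L⁺)`**: for a non-degenerate hermitian `H′ ∈ M_n(L)` and `u : n → L` with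
`σ(u i) · u i = 1`, there is a SEMISIMPLE `γ′ ∈ U(H′)(L⁺)` with `charpoly γ′ = ∏ i, (X − C (u i))` — diagonalise `H′` (★ Landherr `exists_congr_diagonal`)
and conjugate `diag(u)` (★ `exists_isConj_mem_unitaryGroup_of_formCongr_eq_diagonal`). [cite: Rogawski1990, §14.1 p. 232]
[cite: Landherr1936HermitianForms] -/
theorem exists_isSemisimpleElt_charpoly_eq_prod (H' : Matrix n n L) (hH' : (H'.map (cmConjRingHom L))ᵀ = H') (hdet : H'.det ≠ 0)
    (u : n → L) (hu : ∀ i, cmConjRingHom L (u i) * u i = 1) :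
    ∃ γ' : unitaryGroup (cmConjRingHom L) H',
      IsSemisimpleElt (cmConjRingHom L) H' γ' ∧ ((γ' : GL n L) : Matrix n n L).charpoly = ∏ i, (X - C (u i)) := by
  -- diagonalise `H′`
  have hH'L : Landherr.conjTranspose L H' = H' := by rw [landherr_conjTranspose_eq', hH']
  obtain ⟨G, hG, d, -, hd0, hGd⟩ := Landherr.exists_congr_diagonal L H' hH'L hdet
  set g : GL n L := ((Matrix.isUnit_iff_isUnit_det G).mpr hG).unit with hg
  have hgval : (g : Matrix n n L) = G := ((Matrix.isUnit_iff_isUnit_det G).mpr hG).unit_spec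
  have hfc : formCongr (cmConjRingHom L) g H' = Matrix.diagonal d := by
    rw [formCongr, hgval, ← landherr_conjTranspose_eq', hGd]
  -- the diagonal unitary `diag(u)`
  have hu0 : ∀ i, u i ≠ 0 := fun i h0 => by
    have h := hu i
    rw [h0, mul_zero] at h
    exact zero_ne_one h
  have hUunit : IsUnit (Matrix.diagonal u) := by
    rw [Matrix.isUnit_iff_isUnit_det, Matrix.det_diagonal]
    exact IsUnit.mk0 _ (Finset.prod_ne_zero_iff.mpr fun i _ => hu0 i)
  set U : GL n L := hUunit.unit with hU
  have hUval : (U : Matrix n n L) = Matrix.diagonal u := hUunit.unit_spec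
  obtain ⟨γ', hγ'⟩ := exists_isConj_mem_unitaryGroup_of_formCongr_eq_diagonal (cmConjRingHom L) g d hfc U u hUval hu
  refine ⟨γ', ?_, ?_⟩
  · -- semisimple: conjugate to a diagonal matrix
    have hdiag : Module.End.IsSemisimple (Matrix.toLin' ((U : GL n L) : Matrix n n L)) := by
      have h := Literature.LinearAlgebra.Matrix.JordanDecompositionUnique.isSemisimple_of_eq_conj_diagonal (B := (U : Matrix n n L)) (S := 1) (d := u)
        (by rw [Matrix.det_one]; exact isUnit_one) (by rw [hUval, inv_one, Matrix.one_mul, Matrix.mul_one])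
      exact h
    exact (isSemisimple_toLin'_iff_of_isConj hγ').mp hdiag
  · -- characteristic polynomial: conjugation-invariant
    rw [← charpoly_eq_of_isConj_units hγ', hUval, Matrix.charpoly_diagonal]

end Construction

/-! ## §3 Singular semisimple stable classes occur in every inner form -/

section Occurs

variable {H : Matrix (Fin 3) (Fin 3) L}

/-- **Element form**: a semisimple non-regular `γ ∈ U(H)(L⁺)` corresponds (★ `Corresponds`: `GL₃(L)`-conjugacy) to some `γ′ ∈ U(H′)(L⁺)`, for every
non-degenerate hermitian `H′ ∈ M₃(L)` — `γ′` semisimple with the same characteristic polynomial `(X − a)²(X − b)` (§1–§2), conjugate by K6-γ ★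
`isConj_units_of_charpoly_eq_of_isSemisimple`. [cite: Rogawski1990, §14.1 p. 232; §3.8 Prop. 3.8.1 p. 27] -/
theorem exists_corresponds_of_isSemisimpleElt_of_not_isRegularElt (hH : (H.map (cmConjRingHom L))ᵀ = H) (hdet : H.det ≠ 0)
    (H' : Matrix (Fin 3) (Fin 3) L) (hH' : (H'.map (cmConjRingHom L))ᵀ = H') (hdet' : H'.det ≠ 0)
    (γ : unitaryGroup (cmConjRingHom L) H) (hss : IsSemisimpleElt (cmConjRingHom L) H γ) (hnreg : ¬ IsRegularElt (γ : GL (Fin 3) L)) :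
    ∃ γ' : unitaryGroup (cmConjRingHom L) H', IsSemisimpleElt (cmConjRingHom L) H' γ' ∧ Corresponds (cmConjRingHom L) H' H γ' γ := by
  obtain ⟨a, b, ha, hb, hchar⟩ := exists_charpoly_eq_of_isSemisimpleElt_of_not_isRegularElt hH hdet γ hss hnreg
  obtain ⟨γ', hss', hchar'⟩ := exists_isSemisimpleElt_charpoly_eq_prod H' hH' hdet' ![a, a, b] (fun i => by
    fin_cases i <;> assumption)
  refine ⟨γ', hss', ?_⟩
  have heq : ((γ' : GL (Fin 3) L) : Matrix (Fin 3) (Fin 3) L).charpoly = ((γ : GL (Fin 3) L) : Matrix (Fin 3) (Fin 3) L).charpoly := by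
    rw [hchar', hchar, Fin.prod_univ_three]
    simp only [Matrix.cons_val_zero, Matrix.cons_val_one, Matrix.cons_val]
    ring
  exact isConj_units_of_charpoly_eq_of_isSemisimple _ _ hss' hss heq

/-- **HEAD — EVERY SINGULAR SEMISIMPLE STABLE CLASS OCCURS IN EVERY INNER FORM**: for non-degenerate hermitian `H, H′ ∈ M₃(L)` over a CM field,
a stable class `𝒪` of `U(H)(L⁺)` that is SEMISIMPLE (★ `StableClass.IsSemisimple`) and NOT REGULAR (★ `StableClass.IsRegular` fails) OCCURS in
`U(H′)(L⁺)` (★ `StableClass.OccursIn`: some stable class of `U(H′)` corresponds to it).  In particular the singular classes of the quasi-split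
`U(Φ₃)` all occur in the anisotropic `G′ = U(H′)` — unlike regular classes, no local–global obstruction arises (the characteristic polynomial
`(X − a)²(X − b)` is realised by a diagonal unitary in a diagonal frame of `H′`). [cite: Rogawski1990, §14.1 p. 232; §14.5 pp. 238–239; §3.8 Prop. 3.8.1 p. 27] -/
theorem StableClass.occursIn_of_isSemisimple_of_not_isRegular (hH : (H.map (cmConjRingHom L))ᵀ = H) (hdet : H.det ≠ 0)
    (H' : Matrix (Fin 3) (Fin 3) L) (hH' : (H'.map (cmConjRingHom L))ᵀ = H') (hdet' : H'.det ≠ 0)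
    (𝒪 : StableClass (cmConjRingHom L) H) (hss : 𝒪.IsSemisimple) (hnreg : ¬ 𝒪.IsRegular) : 𝒪.OccursIn H' := by
  obtain ⟨γ, rfl⟩ := stableClassOf_surjective 𝒪
  rw [StableClass.isSemisimple_stableClassOf] at hss
  rw [StableClass.isRegular_stableClassOf] at hnreg
  obtain ⟨γ', -, hγ'⟩ := exists_corresponds_of_isSemisimpleElt_of_not_isRegularElt hH hdet H' hH' hdet' γ hss hnreg
  exact StableClass.occursIn_stableClassOf_iff.mpr ⟨γ', hγ'⟩

end Occurs

/-! ## §4 The endoscopic reading: non-`G`-regular semisimple classes of `H` transfer to every inner form -/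

section Endoscopic

variable {J₂ : Matrix (Fin 2) (Fin 2) L} {J₁ : Matrix (Fin 1) (Fin 1) L} {J₃ : Matrix (Fin 3) (Fin 3) L}

/-- **OCCURRENCE OF THE SINGULAR ENDOSCOPIC CLASSES**: let `endoForm J₂ J₁ = J₃` with `J₃` non-degenerate hermitian (e.g. ★ `endoForm_antidiagOne`:
`J₃ = Φ₃`) and let `𝒪_H` be a stable class of `H(L⁺) = U(J₂) × U(J₁)` that is NOT `G`-regular (★ `StableClassH.IsGRegular` fails) and whose image
class `ι(𝒪_H)` in `U(J₃)` (★ `StableClassH.endoImage`) is semisimple.  Then for every non-degenerate hermitian `H′ ∈ M₃(L)` there is a stable class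
`𝒪` of `U(H′)(L⁺)` with `𝒪_H ↦ 𝒪` (★ `StableClassH.TransfersTo`).  (§3 applied to `ι(𝒪_H)`.) [cite: Rogawski1990, §14.5 pp. 238–239; §5.4 Prop. 5.4.1 p. 77] -/
theorem StableClassH.exists_transfersTo_of_not_isGRegular (h : endoForm J₂ J₁ = J₃) (hJ₃ : (J₃.map (cmConjRingHom L))ᵀ = J₃) (hdet₃ : J₃.det ≠ 0)
    (H' : Matrix (Fin 3) (Fin 3) L) (hH' : (H'.map (cmConjRingHom L))ᵀ = H') (hdet' : H'.det ≠ 0)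
    (𝒪H : StableClassH (cmConjRingHom L) J₂ J₁) (hnreg : ¬ 𝒪H.IsGRegular h) (hss : (𝒪H.endoImage h).IsSemisimple) :
    ∃ 𝒪 : StableClass (cmConjRingHom L) H', 𝒪H.TransfersTo H' h 𝒪 := by
  obtain ⟨a, rfl⟩ := stableClassHOf_surjective 𝒪H
  have hnreg' : ¬ (StableClassH.endoImage h (stableClassHOf (cmConjRingHom L) J₂ J₁ a)).IsRegular := hnreg
  rw [StableClassH.endoImage_stableClassHOf] at hss hnreg'
  rw [StableClass.isSemisimple_stableClassOf] at hss
  rw [StableClass.isRegular_stableClassOf] at hnreg'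
  obtain ⟨γ', -, hγ'⟩ := exists_corresponds_of_isSemisimpleElt_of_not_isRegularElt hJ₃ hdet₃ H' hH' hdet' _ hss hnreg'
  exact ⟨stableClassOf (cmConjRingHom L) H' γ', (StableClassH.transfersTo_mk_iff h a γ').mpr (corresponds_comm.mp hγ')⟩

end Endoscopic

end Literature.NumberTheory.Rogawski1990

end
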